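import Mathlib.Topology.Algebra.OpenSubgroup
import Mathlib.Algebra.Group.End
import Mathlib.Algebra.Group.Subgroup.Map
import HarnessLib

/-!
# Arithmetically maximal compact subgroups ([SemiAnbd] §5: Def 5.3, Rmk 5.3.1, Thm 5.4 (i)(ii), Def of "arithmetically quasi-geometric" from Thm 5.4 (iii))

Mochizuki, *Semi-graphs of anabelioids*, Publ. RIMS **42** (2006), §5 pp.65–66 of the author's
manuscript (kurims `paper:url-f33ace170ff4`). [cite: MochizukiSemiAnbd2006, Def 5.3, p. 65]

Setting of p.65: `𝔊` is a connected, countable, totally elevated, totally estranged ARITHMETIC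
semi-graph of anabelioids (Def 5.1) with underlying semi-graph `𝔾`; `Π^temp_𝔊` is its arithmetic
tempered fundamental group with the surjection `Π^temp_𝔊 ↠ Π_A` onto the BC-fundamental group
(Prop 5.2 (iv)); every vertex `v` has a decomposition group `Π^temp_{𝔊,v} ⊆ Π^temp_𝔊` and every
branch `b` of an edge abutting to `v` a decomposition group `Π^temp_{𝔊,b} ⊆ Π^temp_{𝔊,v}`, both
"well-defined up to conjugation in `Π^temp_𝔊`".

This file is PURE GROUP THEORY over Mathlib: the data of p.65 enter as explicit parameters — a
topological group `Gtp` (for `Π^temp_𝔊`; `Π` is a reserved token in Lean 4), a topological group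
`PA` (for `Π_A`), the augmentation `aug : Gtp →* PA`, and a `DecompositionData` recording chosen
representatives `vertGp v`, `brGp b` of the decomposition groups of vertices and branches (any
choice: every definition below is invariant under the conjugations allowed by the text).  Over
these data we DEFINE Def 5.3 (i)–(iii) and the "arithmetically quasi-geometric" homomorphisms of
Thm 5.4 (iii), and we TYPE the assertions of Rmk 5.3.1 and Thm 5.4 (i), (ii) as `Prop`-valued
predicates ON THE DATA (`…Statement`).  They are predicates, not closed named facts: the paper
asserts them for the data arising from an arithmetic semi-graph of anabelioids satisfying the
hypotheses of Thm 5.4 (connected, countable, totally elevated, totally arithmetically estranged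
arithmetic GRAPHS of anabelioids whose arithmetic actions do not switch the branches of any edge),
and the construction of those data (`Π^temp_𝔊`, Prop 5.2 (iv); decomposition groups, §3 Thm 3.7 /
p.65) is typed in the companion files `Arithmetic.lean` / `ArithmeticCoverings.lean` over the
§§1–3 interface (TODO-merge abc-iut-L3-t2 for `π₁^temp`).  Nothing here asserts a result.

Thm 5.4 (iii) itself (the bijection between locally open morphisms `𝔊 → ℍ` over `A` and
arithmetically quasi-geometric morphisms of temperoids) needs the morphisms of Def 5.1 (iv) and
t2's temperoids; it is typed in `ArithmeticCoverings.lean`.  The proof remark "entirely parallel to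
Theorem 3.7, Corollary 3.9" (p.66) is not formalised.
-/

namespace Literature.AnabelianGeometry.SemiGraphs

universe u u' w w'

/-! ### The data of p.65 -/

/-- The data of [SemiAnbd] p.65 over which Def 5.3 is written, for a topological group `Gtp`
playing the role of `Π^temp_𝔊`: the vertices `V` and branches `B` of the underlying semi-graph
(with `edgeOf b` the edge a branch belongs to and `abut b` the vertex it abuts to, if any), and
chosen representatives of "the decomposition group `Π^temp_{𝔊,v} ⊆ Π^temp_𝔊` [well-defined up to
conjugation]" and of "`Π^temp_{𝔊,b} ⊆ Π^temp_{𝔊,v}`" for a branch `b` abutting to `v`.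
INTERFACE for the construction of §3 Thm 3.7 / Prop 5.2 (iv) (TODO-merge abc-iut-L3-t2).
[cite: MochizukiSemiAnbd2006, §5, p. 65] -/
structure DecompositionData (Gtp : Type u) [Group Gtp] (V : Type w) (B : Type w') where
  /-- the set of edges of the underlying semi-graph -/
  E : Type w'
  /-- the edge of which `b` is a branch -/
  edgeOf : B → E
  /-- the vertex to which the branch `b` abuts (`none`: abuts to no vertex) -/
  abut : B → Option V
  /-- a representative of the decomposition group `Π^temp_{𝔊,v}` of the vertex `v` -/
  vertGp : V → Subgroup Gtp
  /-- a representative of the decomposition group `Π^temp_{𝔊,b}` of the branch `b` -/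
  brGp : B → Subgroup Gtp
  /-- "`Π^temp_{𝔊,b} ⊆ Π^temp_{𝔊,v}`" when `b` abuts to `v` (p.65) -/
  brGp_le_vertGp : ∀ (b : B) (v : V), abut b = some v → brGp b ≤ vertGp v

variable {Gtp : Type u} [Group Gtp] [TopologicalSpace Gtp]
variable {PA : Type u'} [Group PA] [TopologicalSpace PA]
variable {V : Type w} {B : Type w'}

/-- The conjugate `g · K · g⁻¹` of a subgroup. [cite: MochizukiSemiAnbd2006, §0, p. 5] -/
def conjSubgroup (g : Gtp) (K : Subgroup Gtp) : Subgroup Gtp := K.map (MulAut.conj g).toMonoidHom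

/-! ### Definition 5.3 -/

/-- **Def 5.3 (i), first clause.** A closed subgroup `K ⊆ Π^temp_𝔊` is *arithmetically ample* if
"it surjects onto an open subgroup of `Π_A`", i.e. its image under the augmentation
`aug : Π^temp_𝔊 ↠ Π_A` is an open subgroup. [cite: MochizukiSemiAnbd2006, Def 5.3 (i), p. 65] -/
def IsArithAmple (aug : Gtp →* PA) (K : Subgroup Gtp) : Prop := IsOpen (K.map aug : Set PA)

/-- **Def 5.3 (i), second clause.** A compact subgroup `K ⊆ Π^temp_𝔊` is *arithmetically maximal*
if it is maximal among arithmetically ample compact subgroups of `Π^temp_𝔊`.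
[cite: MochizukiSemiAnbd2006, Def 5.3 (i), p. 65] -/
def IsArithMaximalCompact (aug : Gtp →* PA) (K : Subgroup Gtp) : Prop :=
  IsCompact (K : Set Gtp) ∧ IsArithAmple aug K ∧
    ∀ K' : Subgroup Gtp, IsCompact (K' : Set Gtp) → IsArithAmple aug K' → K ≤ K' → K' = K

/-- **Def 5.3 (ii), first clause.** The edge `e` is *arithmetically estranged*: "for every vertex
`v` to which some branch `b` of `e` abuts and every `g ∈ Π^temp_{𝔊,v}`, the intersection in
`Π^temp_{𝔊,v}` of `Π^temp_{𝔊,b}` with any subgroup of the form `g · Π^temp_{𝔊,b'} · g⁻¹`, where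
either `b' ≠ b` is a branch of an edge that abuts to `v` or `b' = b` and `g ∉ Π^temp_{𝔊,b}`, fails
to be arithmetically ample" (the arithmetic analogue of "estranged", Def 2.4 (iv) p.26).
[cite: MochizukiSemiAnbd2006, Def 5.3 (ii), p. 65] -/
def IsArithEstrangedEdge (D : DecompositionData Gtp V B) (aug : Gtp →* PA) (e : D.E) : Prop :=
  ∀ (b : B), D.edgeOf b = e → ∀ (v : V), D.abut b = some v → ∀ g ∈ D.vertGp v,
    (∀ b' : B, D.abut b' = some v → b' ≠ b →
        ¬ IsArithAmple aug (D.brGp b ⊓ conjSubgroup g (D.brGp b'))) ∧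
      (g ∉ D.brGp b → ¬ IsArithAmple aug (D.brGp b ⊓ conjSubgroup g (D.brGp b)))

/-- **Def 5.3 (ii), second clause.** `𝔊` is *totally arithmetically estranged*: every edge of its
underlying semi-graph is arithmetically estranged. [cite: MochizukiSemiAnbd2006, Def 5.3 (ii), p. 65] -/
def IsTotallyArithEstranged (D : DecompositionData Gtp V B) (aug : Gtp →* PA) : Prop :=
  ∀ e : D.E, IsArithEstrangedEdge D aug e

/-- **Def 5.3 (iii).** The *verticial* subgroups of `Π^temp_𝔊`: those "of the form `Π^temp_{𝔊,v}`"
— the decomposition groups of vertices, which are defined up to conjugation, so: all conjugates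
of the chosen representatives. [cite: MochizukiSemiAnbd2006, Def 5.3 (iii), p. 65] -/
def IsVerticial (D : DecompositionData Gtp V B) (K : Subgroup Gtp) : Prop :=
  ∃ (v : V) (g : Gtp), K = conjSubgroup g (D.vertGp v)

/-- **Def 5.3 (iii).** The *edge-like* subgroups of `Π^temp_𝔊`: those "of the form `Π^temp_{𝔊,b}`".
[cite: MochizukiSemiAnbd2006, Def 5.3 (iii), p. 65] -/
def IsEdgeLike (D : DecompositionData Gtp V B) (K : Subgroup Gtp) : Prop :=
  ∃ (b : B) (g : Gtp), K = conjSubgroup g (D.brGp b)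

/-! ### Remark 5.3.1 (typed as statements about the data) -/

/-- **Rmk 5.3.1, first sentence** (asserted in print for the data of p.65): "all verticial and
edge-like subgroups of `Π^temp_𝔊` are compact and arithmetically ample".  A predicate on the data;
not proved here. [cite: MochizukiSemiAnbd2006, Rmk 5.3.1, p. 65] -/
def VerticialEdgeLikeCompactAmpleStatement (D : DecompositionData Gtp V B) (aug : Gtp →* PA) :
    Prop :=
  ∀ K : Subgroup Gtp, (IsVerticial D K ∨ IsEdgeLike D K) → IsCompact (K : Set Gtp) ∧ IsArithAmple aug K

/-- **Rmk 5.3.1, second sentence** (asserted in print): "the intersection with `Π^temp_𝔾`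
[= `Ker(Π^temp_𝔊 ↠ Π_A)`, Prop 5.2 (iv)] of a verticial (resp. edge-like) subgroup of `Π^temp_𝔊`
is a verticial (resp. edge-like) subgroup of `Π^temp_𝔾` in the sense of Theorem 3.7".  The
verticial / edge-like subgroups of the GEOMETRIC tempered fundamental group in the sense of Thm 3.7
enter as explicit inputs `IsGeomVerticial`, `IsGeomEdgeLike` (TODO-merge abc-iut-L3-t2, §3
Thm 3.7). [cite: MochizukiSemiAnbd2006, Rmk 5.3.1, p. 65] -/
def IntersectionWithGeometricStatement (D : DecompositionData Gtp V B) (aug : Gtp →* PA)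
    (IsGeomVerticial IsGeomEdgeLike : Subgroup Gtp → Prop) : Prop :=
  (∀ K : Subgroup Gtp, IsVerticial D K → IsGeomVerticial (K ⊓ aug.ker)) ∧
    ∀ K : Subgroup Gtp, IsEdgeLike D K → IsGeomEdgeLike (K ⊓ aug.ker)

/-! ### Theorem 5.4 (i), (ii) (typed as statements about the data) -/

/-- Hypothesis of Thm 5.4: "the arithmetic actions on the underlying graphs … do not switch the
branches of any edge" — for an action of a group `Γ` on the branches (over its action on edges):
no `γ` maps a branch to the other branch of the same edge.
[cite: MochizukiSemiAnbd2006, Thm 5.4, p. 66] -/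
def NoBranchSwitching {Γ : Type*} {E' : Type*} (edgeOf' : B → E') (act : Γ → B → B) : Prop :=
  ∀ (γ : Γ) (b : B), edgeOf' (act γ b) = edgeOf' b → act γ b = b

/-- **Thm 5.4 (i)** (conclusion, as a predicate on the data of p.65; asserted in print when `𝔊`
is a connected, countable, totally elevated, totally arithmetically estranged arithmetic graph of
anabelioids whose arithmetic action does not switch the branches of any edge): "Every
arithmetically ample compact subgroup of `π₁^temp(𝔊)` is contained in at least one verticial
subgroup.  If [it] is contained in more than one verticial subgroup, then it is contained in
precisely two verticial subgroups, whose intersection forms an edge-like subgroup."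
[cite: MochizukiSemiAnbd2006, Thm 5.4 (i), p. 66] -/
def ArithMaximalCompactStatementI (D : DecompositionData Gtp V B) (aug : Gtp →* PA) : Prop :=
  ∀ K : Subgroup Gtp, IsCompact (K : Set Gtp) → IsArithAmple aug K →
    (∃ W : Subgroup Gtp, IsVerticial D W ∧ K ≤ W) ∧
      ∀ W₁ W₂ : Subgroup Gtp, IsVerticial D W₁ → IsVerticial D W₂ → W₁ ≠ W₂ → K ≤ W₁ → K ≤ W₂ →
        (∀ W₃ : Subgroup Gtp, IsVerticial D W₃ → K ≤ W₃ → W₃ = W₁ ∨ W₃ = W₂) ∧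
          IsEdgeLike D (W₁ ⊓ W₂)

/-- **Thm 5.4 (ii)** (conclusion, as a predicate on the data; same hypotheses as (i)): "The
arithmetically maximal compact subgroups of `π₁^temp(𝔊)` are precisely the verticial subgroups.
The arithmetically ample intersections of two distinct arithmetically maximal compact subgroups of
`π₁^temp(𝔊)` are precisely the edge-like subgroups." [cite: MochizukiSemiAnbd2006, Thm 5.4 (ii), p. 66] -/
def ArithMaximalCompactStatementII (D : DecompositionData Gtp V B) (aug : Gtp →* PA) : Prop :=
  (∀ K : Subgroup Gtp, IsArithMaximalCompact aug K ↔ IsVerticial D K) ∧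
    ∀ K : Subgroup Gtp,
      (IsArithAmple aug K ∧ ∃ M₁ M₂ : Subgroup Gtp, IsArithMaximalCompact aug M₁ ∧
          IsArithMaximalCompact aug M₂ ∧ M₁ ≠ M₂ ∧ K = M₁ ⊓ M₂) ↔
        IsEdgeLike D K

/-! ### "Arithmetically quasi-geometric" homomorphisms (the group-theoretic notion of Thm 5.4 (iii)) -/

section QuasiGeometric

variable {Htp : Type*} [Group Htp] [TopologicalSpace Htp]

/-- `φ(K₁)` is an open subgroup of `K₂`: contained in `K₂` and open for the subspace topology of
`K₂`. [cite: MochizukiSemiAnbd2006, Thm 5.4 (iii), p. 66] -/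
def MapsOntoOpenSubgroupOf (φ : Gtp →* Htp) (K₁ : Subgroup Gtp) (K₂ : Subgroup Htp) : Prop :=
  K₁.map φ ≤ K₂ ∧ IsOpen ((Subtype.val : K₂ → Htp) ⁻¹' (K₁.map φ : Set Htp))

/-- **Thm 5.4 (iii), the defining condition.** A continuous homomorphism
`φ : Π^temp_𝔊 → Π^temp_ℍ` (compatible with the augmentations to `Π_A`) is *arithmetically
quasi-geometric* if it "maps any arithmetically maximal compact subgroup `K₁ ⊆ Π^temp_𝔊`
(respectively, arithmetically ample intersection `K₁ ∩ H₁` of two distinct arithmetically maximal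
compact subgroups `K₁, H₁ ⊆ Π^temp_𝔊`) to an open subgroup of some arithmetically maximal compact
subgroup `K₂ ⊆ Π^temp_ℍ` (respectively, of some arithmetically ample intersection `K₂ ∩ H₂` of two
distinct arithmetically maximal compact subgroups `K₂, H₂ ⊆ Π^temp_ℍ`)" (the arithmetic analogue
of "quasi-geometric", Def 3.8 p.42). [cite: MochizukiSemiAnbd2006, Thm 5.4 (iii), p. 66] -/
def IsArithQuasiGeometric (augG : Gtp →* PA) (augH : Htp →* PA) (φ : Gtp →* Htp) : Prop :=
  Continuous φ ∧ augH.comp φ = augG ∧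
    (∀ K₁ : Subgroup Gtp, IsArithMaximalCompact augG K₁ →
        ∃ K₂ : Subgroup Htp, IsArithMaximalCompact augH K₂ ∧ MapsOntoOpenSubgroupOf φ K₁ K₂) ∧
      ∀ K₁ H₁ : Subgroup Gtp, IsArithMaximalCompact augG K₁ → IsArithMaximalCompact augG H₁ →
        K₁ ≠ H₁ → IsArithAmple augG (K₁ ⊓ H₁) →
          ∃ K₂ H₂ : Subgroup Htp, IsArithMaximalCompact augH K₂ ∧ IsArithMaximalCompact augH H₂ ∧
            K₂ ≠ H₂ ∧ IsArithAmple augH (K₂ ⊓ H₂) ∧ MapsOntoOpenSubgroupOf φ (K₁ ⊓ H₁) (K₂ ⊓ H₂)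

end QuasiGeometric

/-! ### Elementary consequences of the definitions (bookkeeping, proved) -/

omit [TopologicalSpace Gtp] in
/-- Verticial subgroups are closed under conjugation (they are "defined up to conjugation").
[cite: MochizukiSemiAnbd2006, Def 5.3 (iii), p. 65] -/
theorem IsVerticial.conj {D : DecompositionData Gtp V B} {K : Subgroup Gtp} (hK : IsVerticial D K)
    (g : Gtp) : IsVerticial D (conjSubgroup g K) := by
  obtain ⟨v, g₀, rfl⟩ := hK
  refine ⟨v, g * g₀, ?_⟩
  simp only [conjSubgroup, Subgroup.map_map]
  congr 1
  ext x
  simp [MulAut.conj_apply, mul_assoc]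

omit [TopologicalSpace Gtp] in
/-- Edge-like subgroups are closed under conjugation. [cite: MochizukiSemiAnbd2006, Def 5.3 (iii), p. 65] -/
theorem IsEdgeLike.conj {D : DecompositionData Gtp V B} {K : Subgroup Gtp} (hK : IsEdgeLike D K)
    (g : Gtp) : IsEdgeLike D (conjSubgroup g K) := by
  obtain ⟨b, g₀, rfl⟩ := hK
  refine ⟨b, g * g₀, ?_⟩
  simp only [conjSubgroup, Subgroup.map_map]
  congr 1
  ext x
  simp [MulAut.conj_apply, mul_assoc]

/-- An arithmetically maximal compact subgroup is, in particular, compact and arithmetically ample.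
[cite: MochizukiSemiAnbd2006, Def 5.3 (i), p. 65] -/
theorem IsArithMaximalCompact.isCompact_and_isArithAmple {aug : Gtp →* PA} {K : Subgroup Gtp}
    (hK : IsArithMaximalCompact aug K) : IsCompact (K : Set Gtp) ∧ IsArithAmple aug K :=
  ⟨hK.1, hK.2.1⟩

/-- Under Thm 5.4 (ii), verticial subgroups are arithmetically maximal compact (bookkeeping
consequence of the typed statement). [cite: MochizukiSemiAnbd2006, Thm 5.4 (ii), p. 66] -/
theorem ArithMaximalCompactStatementII.isArithMaximalCompact_of_isVerticial
    {D : DecompositionData Gtp V B} {aug : Gtp →* PA} (h : ArithMaximalCompactStatementII D aug)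
    {K : Subgroup Gtp} (hK : IsVerticial D K) : IsArithMaximalCompact aug K :=
  (h.1 K).2 hK

end Literature.AnabelianGeometry.SemiGraphs
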